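import Summits.QuantumFields.BalabanUV.Beta.EriceRemainderEnclosureHistoryAutonomyComparisonAgeCompositionYoungPairMoment

/-!
# EriceRemainderEnclosureHistoryAutonomyComparisonAgeCompositionOldPairLetters — (E99a) route (N), first order: THE OLD-PAIR POLYTOPE.  Two near
# OLD ages `j < k ≤ 2j` share ONE rise budget: along every admissible flow the loads `x = x_j(m) = j·L_jh_{m+j}³∕2`, `y = x_k(m) = k·L_kh_{m+k}³∕2`
# and the level ratio `σ = h_{m+j}∕h_{m+k}` satisfy `1 ≤ σ`, `σ²·j ≤ k` and the two WINDOW LETTERS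
#   (K)  `(2c_a((k−j)∕j)∕σ² + 2c_b∕σ³)·x + 2c_K·y ≤ 1`   (the `k` reads over `[m, m+k)` against the rise `1∕h_{m+k}²`),
#   (J)  `2c_J·x + 2c_b·σ²·(j∕k)·y ≤ 1`                  (the `j` reads over `[m, m+j)` against the rise `1∕h_{m+j}²`),
# every level inside a window lying under the RAY from the pin through the age's own level (`p·h_{m+p}² ≤ (p+t)·h_{m+p+t}²`, (E90b)) and every
# window sum of such levels bounded below by the tangent of `t ↦ t^{-1∕2}` at the window's mean (`c²(2p+n+1) ≤ 2p` for `n` levels after the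
# level `p`: **`ray_sum_ge`**, the offset form of (E94b) `window_sum_ge`).  On this polytope `x + y ≤ 0.617` (the sequel (E99b) `…OldPairCap`):
# at every `σ` ONE of the two letters alone has both coefficients `≥ 1∕0.617` — **`old_pair_box`**, the pure dichotomy on a box
# `F₁ ≤ k∕j ≤ F₂` with a threshold LINEAR in `k∕j` (`σ²·2c_bV ≶ k∕j`), five rational side conditions, no multipliers.
# Numerics (`HOME/b2b-balaban-beta-d4-p2/g87/numerics/`): the TRUE supremum of `x_j + x_k` over admissible flows is `0.58–0.59` for `k ≤ 2j`
# (gen 86 kit j340398); the two letters with exact sums give `0.607`, with the tangent constants `0.6148` (`j = 56`) ↘ `0.6136`; `0.617` is what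
# the ×61 cluster cascade of (E95c)∕(E97c) tolerates from an older level at `κ = 1∕5` (`0.2 + 4·0.617·1.2 = 3.1616 ≤ 61·0.2596·0.2 = 3.1671`)

Cell `pub-balaban`, β-function sub-cell, BINDER row D4 «RemainderConst leaves for Bałaban's split» (`HOME/BINDER-OWNERS.md`; owner lineage `b2b-balaban-beta-an4`;
this file by co-owner #2 lineage `b2b-balaban-beta-d4-p2`, generation 87), β-FLOW TEAM duty (1), FREEZE (0) honoured (def-free; nothing restated).

HONEST FRAMING (page 1, verbatim and binding).  *"Discharging BetaPertH makes Bałaban's UV stability UNCONDITIONAL — a real constructive-QFT result; it is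
NOT the continuum limit and NOT the Clay problem."*  THIS FILE DISCHARGES NOTHING OF THE KIND.  Elementary real algebra ∕ real analysis about ABSTRACT
functionals on a box ]0,γ]^ℕ with displayed floors, profiles and signs, and the FIRST-ORDER renewal objects of route (N) built from them — hypotheses of a
census, not facts; the form, signs, ages and moments of Bałaban's (1.22) limit functional are NOT PRINTED ([I] p. 298; GAPS G-t4-U2-1∕-2) and NOT asserted.
Row D4 class UNCHANGED (critical-path width 0; instance 0∕1; D4 DISCHARGE NO DATE).  HONEST DEPENDENCY: continuum YM on T⁴ ⇐ BetaPertH ∧ nine spine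
estimates (0/9 proved); BetaPertH ⇐ (D1) ∧ (D4) ∧ CAP+tail; G-an2-4 gates asym, D1 and NE2/3/4.

THE POINT (README `HOME/b2b-balaban-beta-d4-p2/g87/README.md` §2).  Gen 86 measured that a near old pair `{j,k}`, `k ≤ 2j`, carries no more load than one
old age (`0.59` against the single-age `0.58`), while the crude cap of (E92b) is `√2∕(1+p₀) ≈ 0.73–0.77` and two single caps give `1.23`: the two ages
share ONE rise `1∕h_{m+k}² − 1∕h_m²` ((E88d) `invSq_sub_ge_all_reads`).  The letters: in the `k`-window the `k` reads of age `k` see levels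
`h_{m+k+t} ≥ h_{m+k}√(k∕(k+t))`, the reads of age `j` see `h_{m+j+t} ≥ h_{m+j}√(j∕(j+t))` on the stretch `(m+j, m+k]` and `≥ h_{m+k}√(k∕(k+t))` beyond;
in the `j`-window the `j` reads of age `j` are its own window and those of age `k` see the far window `(m+k, m+k+j]` again.  Uses (E94b) `window_sum_ge`∕
`tangent_term_le`, (E92c) `sum_range_succ_real`, (E90b) `mul_sq_le_from_pin`, (E88d) `invSq_sub_ge_all_reads`, (E92b) `two_terms_le_reads`, (E79)
`strictAnti_of_memFlow` BY NAME.  NOT CLAIMED: spans `k > 2j` (the same letters give `0.626` at `k = 3j`, `0.637` at `4j`); anything printed — NOT B12 Thm 2,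
NOT BetaPertH, NOT continuum, NOT Clay.

WHAT IS PROVED ([folklore]; 0 `def`, 0 sorry).  §1 `sum_ray_tangent`, **`ray_sum_ge`** (`c·n·h_{m+p} ≤ Σ_{q<n} h_{m+p+1+q}` for `c²(2p+n+1) ≤ 2p`).
§2 **`old_pair_letters`**.  §3 **`old_pair_box`** (pure).
-/
noncomputable section
open Finset

namespace Summit.QuantumFields.BalabanUV.Beta.EriceRemainderEnclosureHistoryAutonomyComparisonAgeCompositionOldPairLetters

open Literature.MathematicalPhysics.QuantumFieldTheory.Balaban1983to89
open Literature.MathematicalPhysics.QuantumFieldTheory.Balaban1983to89.T4BetaStationary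
open Literature.MathematicalPhysics.QuantumFieldTheory.Balaban1983to89.T4BetaFlowWellPosed
open Summit.QuantumFields.BalabanUV.Beta.EriceRemainderEnclosureHistoryAutonomyOrder (strictAnti_of_memFlow)
open Summit.QuantumFields.BalabanUV.Beta.EriceRemainderEnclosureHistoryAutonomyComparisonAgeCompositionWindowShares (mul_sq_le_from_pin)
open Summit.QuantumFields.BalabanUV.Beta.EriceRemainderEnclosureHistoryAutonomyComparisonAgeCompositionThreeAgesFlowReads (invSq_sub_ge_all_reads)
open Summit.QuantumFields.BalabanUV.Beta.EriceRemainderEnclosureHistoryAutonomyComparisonAgeCompositionPairShares (two_terms_le_reads)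
open Summit.QuantumFields.BalabanUV.Beta.EriceRemainderEnclosureHistoryAutonomyComparisonAgeCompositionNestedMoments (sum_range_succ_real)
open Summit.QuantumFields.BalabanUV.Beta.EriceRemainderEnclosureHistoryAutonomyComparisonAgeCompositionYoungPairMoment (tangent_term_le window_sum_ge)

variable {B : (ℕ → ℝ) → ℝ} {γ b gIR : ℝ} {L : ℕ → ℝ} {K : ℕ} {h : ℕ → ℝ}

/-! ## §1 Levels after a level, under the ray from the pin -/

/-- `Σ_{q<n} (3a − (p+1+q)) = 2a·n` for `a = (2p+n+1)∕2`, the mean of `p+1, …, p+n` ((E92c) `sum_range_succ_real`). [folklore] -/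
theorem sum_ray_tangent (p n : ℕ) :
    ∑ q ∈ range n, (3 * ((2 * (p : ℝ) + n + 1) / 2) - ((p : ℝ) + 1 + q)) = 2 * ((2 * (p : ℝ) + n + 1) / 2) * n := by
  have hs := sum_range_succ_real n
  have e : ∀ q : ℕ, (3 * ((2 * (p : ℝ) + n + 1) / 2) - ((p : ℝ) + 1 + q))
      = (3 * ((2 * (p : ℝ) + n + 1) / 2) - p) - ((q : ℝ) + 1) := fun q => by ring
  rw [sum_congr rfl fun q _ => e q, sum_sub_distrib, sum_const, card_range, hs, nsmul_eq_mul]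
  ring

/-- **LEVELS AFTER A LEVEL, UNDER THE RAY FROM THE PIN.**  `B` an isotone memory with floor `b > 0`, `h` a box solution, a level `p ≥ 1` past the pin
`m`, `n` further scales and any real `c` with `c²(2p+n+1) ≤ 2p`: `c·n·h_{m+p} ≤ Σ_{q<n} h_{m+p+1+q}` — every level `h_{m+p+t}` lies under the ray
`p·h_{m+p}² ≤ (p+t)·h_{m+p+t}²` ((E90b) `mul_sq_le_from_pin`) and `Σ_{t=1}^{n} √(p∕(p+t)) ≥ n√(2p∕(2p+n+1))` by the tangent of `t^{-1∕2}` at the mean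
`(2p+n+1)∕2` ((E94b) `tangent_term_le`; `window_sum_ge` is the case `n = p`). [folklore] -/
theorem ray_sum_ge (hmono : ∀ u v : ℕ → ℝ, SeqBox γ u → SeqBox γ v → (∀ j, u j ≤ v j) → B u ≤ B v) (hb : 0 < b)
    (hlo : ∀ u, SeqBox γ u → b ≤ B u) (hh : SeqBox γ h) (hf : MemFlow B gIR h) {p : ℕ} (hp : 1 ≤ p) (n : ℕ) {c : ℝ}
    (hc : c ^ 2 * (2 * (p : ℝ) + n + 1) ≤ 2 * p) (m : ℕ) : c * n * h (m + p) ≤ ∑ q ∈ range n, h (m + p + 1 + q) := by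
  have hpos : ∀ n, 0 < h n := fun n => (hh n).1
  have hpr : (1 : ℝ) ≤ p := by exact_mod_cast hp
  obtain ⟨a, ha_def⟩ : ∃ a : ℝ, a = (2 * (p : ℝ) + n + 1) / 2 := ⟨_, rfl⟩
  have ha : 0 < a := by rw [ha_def]; positivity
  have hca : c ^ 2 * a ≤ p := by rw [ha_def]; nlinarith [hc]
  have hs := sum_ray_tangent p n
  rw [← ha_def] at hs
  have per : ∀ q ∈ range n, c * (3 * a - ((p : ℝ) + 1 + q)) / (2 * a) * h (m + p) ≤ h (m + p + 1 + q) := by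
    intro q hq
    have hqn : (q : ℝ) + 1 ≤ n := by exact_mod_cast Nat.succ_le_of_lt (mem_range.mp hq)
    have hray := mul_sq_le_from_pin hmono hb hlo hh hf m p (q + 1)
    rw [show m + p + (q + 1) = m + p + 1 + q by ring] at hray
    push_cast at hray
    have := tangent_term_le ha (t := (p : ℝ) + 1 + q) (h₀ := h (m + p)) (by rw [ha_def]; linarith) hca
      (hpos (m + p + 1 + q)).le (by linarith [hray])
    rw [div_mul_eq_mul_div, div_le_iff₀ (by positivity)]
    linarith
  calc c * n * h (m + p) = c / (2 * a) * (2 * a * n) * h (m + p) := by field_simp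
    _ = c / (2 * a) * (∑ q ∈ range n, (3 * a - ((p : ℝ) + 1 + q))) * h (m + p) := by rw [hs]
    _ = ∑ q ∈ range n, c * (3 * a - ((p : ℝ) + 1 + q)) / (2 * a) * h (m + p) := by
        rw [mul_sum, sum_mul]; exact sum_congr rfl fun q _ => by ring
    _ ≤ ∑ q ∈ range n, h (m + p + 1 + q) := sum_le_sum per

/-! ## §2 The old-pair polytope at a pin -/

/-- **THE OLD-PAIR POLYTOPE AT A PIN.**  Ages `1 ≤ j < k < K` loaded (any others allowed, `L ≥ 0`); `σ = h_{m+j}∕h_{m+k}`, `x = j·L_jh_{m+j}³∕2`,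
`y = k·L_kh_{m+k}³∕2`; rational-friendly constants with `c_K²(3k+1) ≤ 2k`, `c_J²(3j+1) ≤ 2j` (own windows), `c_a²(j+k+1) ≤ 2j` (the stretch `(m+j, m+k]`
under the ray through `m+j`), `c_b²(2k+j+1) ≤ 2k` (the far window `(m+k, m+k+j]` under the ray through `m+k`).  Then `1 ≤ σ`, `σ²·j ≤ k`, the LETTER K
`(2c_a((k−j)∕j)∕σ² + 2c_b∕σ³)·x + 2c_K·y ≤ 1` (all reads over `[m, m+k)` `≤ 1∕h_{m+k}²`, (E88d)) and the LETTER J `2c_J·x + 2c_b·σ²·(j∕k)·y ≤ 1` (all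
reads over `[m, m+j)` `≤ 1∕h_{m+j}²`). [folklore] -/
theorem old_pair_letters (hmono : ∀ u v : ℕ → ℝ, SeqBox γ u → SeqBox γ v → (∀ j, u j ≤ v j) → B u ≤ B v)
    (hL : ∀ k, 0 ≤ L k) (hb : 0 < b) (hlo : ∀ u, SeqBox γ u → b ≤ B u) (hdom : ∀ u, SeqBox γ u → ∑ k ∈ range K, L k * u k ≤ B u)
    (hh : SeqBox γ h) (hf : MemFlow B gIR h) {j k : ℕ} (hj : 1 ≤ j) (hjk : j < k) (hkK : k < K) {cK cJ ca cb : ℝ}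
    (hcK : cK ^ 2 * (3 * (k : ℝ) + 1) ≤ 2 * k) (hcJ : cJ ^ 2 * (3 * (j : ℝ) + 1) ≤ 2 * j)
    (hca : ca ^ 2 * ((j : ℝ) + k + 1) ≤ 2 * j) (hcb : cb ^ 2 * (2 * (k : ℝ) + j + 1) ≤ 2 * k) (m : ℕ) :
    1 ≤ h (m + j) / h (m + k) ∧ (h (m + j) / h (m + k)) ^ 2 * j ≤ k
    ∧ (2 * ca * (((k : ℝ) - j) / j) / (h (m + j) / h (m + k)) ^ 2 + 2 * cb / (h (m + j) / h (m + k)) ^ 3)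
        * ((j : ℝ) * (L j * h (m + j) ^ 3 / 2)) + 2 * cK * ((k : ℝ) * (L k * h (m + k) ^ 3 / 2)) ≤ 1
    ∧ 2 * cJ * ((j : ℝ) * (L j * h (m + j) ^ 3 / 2))
        + 2 * cb * (h (m + j) / h (m + k)) ^ 2 * ((j : ℝ) / k) * ((k : ℝ) * (L k * h (m + k) ^ 3 / 2)) ≤ 1 := by
  have hpos : ∀ n, 0 < h n := fun n => (hh n).1
  have hanti := (strictAnti_of_memFlow hb hlo hh hf).antitone
  have hjK : j < K := lt_trans hjk hkK
  have hk1 : 1 ≤ k := by omega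
  have hjr : (1 : ℝ) ≤ j := by exact_mod_cast hj
  have hjkr : (j : ℝ) + 1 ≤ k := by exact_mod_cast hjk
  have hmj := hpos (m + j); have hmk := hpos (m + k)
  have hLj := hL j; have hLk := hL k
  -- σ ≥ 1 and σ²·j ≤ k (the ray from the pin through m+j reaches m+k)
  have hσ1 : 1 ≤ h (m + j) / h (m + k) := by rw [le_div_iff₀ hmk, one_mul]; exact hanti (by omega)
  have hσ2 : (h (m + j) / h (m + k)) ^ 2 * j ≤ k := by
    have := mul_sq_le_from_pin hmono hb hlo hh hf m j (k - j)
    rw [show m + j + (k - j) = m + k by omega, Nat.cast_sub hjk.le] at this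
    rw [div_pow, div_mul_eq_mul_div, div_le_iff₀ (pow_pos hmk 2)]
    linarith
  -- the four ray sums
  have hWk : cK * k * h (m + k) ≤ ∑ q ∈ range k, h (m + k + 1 + q) := window_sum_ge hmono hb hlo hh hf hk1 hcK m
  have hWj : cJ * j * h (m + j) ≤ ∑ q ∈ range j, h (m + j + 1 + q) := window_sum_ge hmono hb hlo hh hf hj hcJ m
  have hRa : ca * ((k - j : ℕ) : ℝ) * h (m + j) ≤ ∑ q ∈ range (k - j), h (m + j + 1 + q) :=
    ray_sum_ge hmono hb hlo hh hf hj (k - j) (by rw [Nat.cast_sub hjk.le]; linarith [hca]) m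
  have hRb : cb * j * h (m + k) ≤ ∑ q ∈ range j, h (m + k + 1 + q) := ray_sum_ge hmono hb hlo hh hf hk1 j hcb m
  refine ⟨hσ1, hσ2, ?_, ?_⟩
  · -- LETTER K: the k reads over [m, m+k) are below the rise 1∕h_{m+k}²
    have hwin : ∑ q ∈ range k, (L j * h (m + q + 1 + j) + L k * h (m + q + 1 + k)) ≤ 1 / h (m + k) ^ 2 := by
      have e1 := invSq_sub_ge_all_reads hdom hh hf m k
      have e2 : ∑ q ∈ range k, (L j * h (m + q + 1 + j) + L k * h (m + q + 1 + k))
          ≤ ∑ q ∈ range k, ∑ i ∈ range K, L i * h (m + q + 1 + i) :=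
        sum_le_sum fun q _ => two_terms_le_reads hL hh (ne_of_lt hjk) hjK hkK (m + q + 1)
      have e3 : 0 < 1 / h m ^ 2 := by have := hpos m; positivity
      linarith
    rw [sum_add_distrib] at hwin
    have hKk : L k * (cK * k * h (m + k)) ≤ ∑ q ∈ range k, L k * h (m + q + 1 + k) := by
      rw [← mul_sum]
      refine mul_le_mul_of_nonneg_left (hWk.trans_eq (sum_congr rfl fun q _ => ?_)) hLk
      rw [show m + k + 1 + q = m + q + 1 + k by ring]
    have hKj : L j * (ca * ((k - j : ℕ) : ℝ) * h (m + j) + cb * j * h (m + k)) ≤ ∑ q ∈ range k, L j * h (m + q + 1 + j) := by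
      have hsplit : ∑ q ∈ range k, h (m + q + 1 + j)
          = ∑ q ∈ range (k - j), h (m + j + 1 + q) + ∑ q ∈ range j, h (m + k + 1 + q) := by
        have hkj : k = (k - j) + j := by omega
        conv_lhs => rw [hkj]
        rw [sum_range_add]
        congr 1
        · exact sum_congr rfl fun q _ => by rw [show m + q + 1 + j = m + j + 1 + q by ring]
        · exact sum_congr rfl fun q _ => by rw [show m + (k - j + q) + 1 + j = m + k + 1 + q by omega]
      rw [← mul_sum, hsplit]
      exact mul_le_mul_of_nonneg_left (add_le_add hRa hRb) hLj
    have hsum : L k * (cK * k * h (m + k)) + L j * (ca * ((k - j : ℕ) : ℝ) * h (m + j) + cb * j * h (m + k)) ≤ 1 / h (m + k) ^ 2 := by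
      linarith
    have key := mul_le_mul_of_nonneg_left hsum (sq_nonneg (h (m + k)))
    have e1 : h (m + k) ^ 2 * (1 / h (m + k) ^ 2) = 1 := by field_simp
    have e2 : h (m + k) ^ 2 * (L k * (cK * k * h (m + k)) + L j * (ca * ((k - j : ℕ) : ℝ) * h (m + j) + cb * j * h (m + k)))
        = (2 * ca * (((k : ℝ) - j) / j) / (h (m + j) / h (m + k)) ^ 2 + 2 * cb / (h (m + j) / h (m + k)) ^ 3)
            * ((j : ℝ) * (L j * h (m + j) ^ 3 / 2)) + 2 * cK * ((k : ℝ) * (L k * h (m + k) ^ 3 / 2)) := by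
      rw [Nat.cast_sub hjk.le]
      field_simp
      ring
    rw [e1, e2] at key
    exact key
  · -- LETTER J: the j reads over [m, m+j) are below the rise 1∕h_{m+j}²
    have hwin : ∑ q ∈ range j, (L j * h (m + q + 1 + j) + L k * h (m + q + 1 + k)) ≤ 1 / h (m + j) ^ 2 := by
      have e1 := invSq_sub_ge_all_reads hdom hh hf m j
      have e2 : ∑ q ∈ range j, (L j * h (m + q + 1 + j) + L k * h (m + q + 1 + k))
          ≤ ∑ q ∈ range j, ∑ i ∈ range K, L i * h (m + q + 1 + i) :=
        sum_le_sum fun q _ => two_terms_le_reads hL hh (ne_of_lt hjk) hjK hkK (m + q + 1)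
      have e3 : 0 < 1 / h m ^ 2 := by have := hpos m; positivity
      linarith
    rw [sum_add_distrib] at hwin
    have hJj : L j * (cJ * j * h (m + j)) ≤ ∑ q ∈ range j, L j * h (m + q + 1 + j) := by
      rw [← mul_sum]
      refine mul_le_mul_of_nonneg_left (hWj.trans_eq (sum_congr rfl fun q _ => ?_)) hLj
      rw [show m + j + 1 + q = m + q + 1 + j by ring]
    have hJk : L k * (cb * j * h (m + k)) ≤ ∑ q ∈ range j, L k * h (m + q + 1 + k) := by
      rw [← mul_sum]
      refine mul_le_mul_of_nonneg_left (hRb.trans_eq (sum_congr rfl fun q _ => ?_)) hLk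
      rw [show m + k + 1 + q = m + q + 1 + k by ring]
    have hsum : L j * (cJ * j * h (m + j)) + L k * (cb * j * h (m + k)) ≤ 1 / h (m + j) ^ 2 := by linarith
    have key := mul_le_mul_of_nonneg_left hsum (sq_nonneg (h (m + j)))
    have e1 : h (m + j) ^ 2 * (1 / h (m + j) ^ 2) = 1 := by field_simp
    have e2 : h (m + j) ^ 2 * (L j * (cJ * j * h (m + j)) + L k * (cb * j * h (m + k)))
        = 2 * cJ * ((j : ℝ) * (L j * h (m + j) ^ 3 / 2))
          + 2 * cb * (h (m + j) / h (m + k)) ^ 2 * ((j : ℝ) / k) * ((k : ℝ) * (L k * h (m + k) ^ 3 / 2)) := by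
      field_simp
    rw [e1, e2] at key
    exact key

/-! ## §3 The dichotomy on a box of the span (pure) -/

/-- **ONE BOX OF THE OLD-PAIR CAP (pure dichotomy, no multipliers).**  Reals `x, y ≥ 0`, `σ > 0`, ages as reals `0 < jr`, `F₁·jr ≤ kr ≤ F₂·jr`
(`F₁ ≥ 1`), letters K `(2c_a((kr−jr)∕jr)∕σ² + 2c_b∕σ³)x + 2c_Ky ≤ 1` and J `2c_Jx + 2c_bσ²(jr∕kr)y ≤ 1` (`c_a, c_b ≥ 0`), a value `V > 0` with
`2c_KV ≥ 1`, `2c_JV ≥ 1`, and a rational witness `sh > 0` with `F₂ ≤ 2c_bV·sh²`, `c_b ≤ c_a·sh`, `1 ≤ V·(4c_ac_bV(1 − 1∕F₁) + 4c_b²V∕(F₁·sh))`.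
THEN `x + y ≤ V`: if `kr ≤ 2c_bσ²V·jr` the J-coefficient of `y` is `≥ 1∕V` (letter J alone); otherwise `σ < sh`, `1∕σ² > 2c_bV·jr∕kr`,
`1∕σ³ > 2c_bV·jr∕(kr·sh)`, so the K-coefficient of `x` exceeds `4c_ac_bV(1 − jr∕kr) + 4c_b²V(jr∕kr)∕sh`, non-increasing in `jr∕kr ≤ 1∕F₁`, hence
`≥ 1∕V` (letter K alone). [folklore] -/
theorem old_pair_box {x y σ jr kr V cK cJ ca cb F₁ F₂ sh : ℝ} (hx : 0 ≤ x) (hy : 0 ≤ y) (hσ : 0 < σ) (hjr : 0 < jr)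
    (hk1 : F₁ * jr ≤ kr) (hk2 : kr ≤ F₂ * jr) (hF1 : 1 ≤ F₁) (hV : 0 < V) (hca0 : 0 ≤ ca) (hcb0 : 0 ≤ cb) (hsh : 0 < sh)
    (hK : (2 * ca * ((kr - jr) / jr) / σ ^ 2 + 2 * cb / σ ^ 3) * x + 2 * cK * y ≤ 1)
    (hJ : 2 * cJ * x + 2 * cb * σ ^ 2 * (jr / kr) * y ≤ 1)
    (hcKV : 1 ≤ 2 * cK * V) (hcJV : 1 ≤ 2 * cJ * V) (hc3 : F₂ ≤ 2 * cb * V * sh ^ 2) (hc4 : cb ≤ ca * sh)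
    (hc5 : 1 ≤ V * (4 * ca * cb * V * (1 - 1 / F₁) + 4 * cb ^ 2 * V / (F₁ * sh))) : x + y ≤ V := by
  have hkr : 0 < kr := by nlinarith
  have hjk : jr ≤ kr := by nlinarith
  have ht1 : jr / kr ≤ 1 / F₁ := by
    rw [div_le_div_iff₀ hkr (by linarith)]; linarith
  rcases le_or_gt kr (2 * cb * σ ^ 2 * V * jr) with hc | hc
  · -- LETTER J alone
    have hbV : 1 ≤ V * (2 * cb * σ ^ 2 * (jr / kr)) := by
      rw [show V * (2 * cb * σ ^ 2 * (jr / kr)) = V * (2 * cb * σ ^ 2 * jr) / kr by ring, le_div_iff₀ hkr]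
      linarith
    have h1 : x ≤ V * (2 * cJ * x) := by linarith [mul_le_mul_of_nonneg_left hcJV hx]
    have h2 : y ≤ V * (2 * cb * σ ^ 2 * (jr / kr) * y) := by linarith [mul_le_mul_of_nonneg_left hbV hy]
    linarith [mul_le_mul_of_nonneg_left hJ hV.le]
  · -- LETTER K alone
    have hcb : 0 < cb := by
      rcases hcb0.lt_or_eq with h0 | h0
      · exact h0
      · exfalso; rw [← h0] at hc3; nlinarith
    have hσsh : σ < sh := by
      by_contra hnot
      push Not at hnot
      have h1 : sh ^ 2 ≤ σ ^ 2 := pow_le_pow_left₀ hsh.le hnot 2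
      have h2 : 2 * cb * V * sh ^ 2 * jr ≤ 2 * cb * V * σ ^ 2 * jr :=
        mul_le_mul_of_nonneg_right (mul_le_mul_of_nonneg_left h1 (by positivity)) hjr.le
      nlinarith
    have hw1 : 2 * cb * V * (jr / kr) ≤ 1 / σ ^ 2 := by
      rw [show 2 * cb * V * (jr / kr) = 2 * cb * V * jr / kr by ring, div_le_div_iff₀ hkr (pow_pos hσ 2)]
      nlinarith
    have hw2 : 1 / sh ≤ 1 / σ := one_div_le_one_div_of_le hσ hσsh.le
    have hw3 : 2 * cb * V * (jr / kr) * (1 / sh) ≤ 1 / σ ^ 2 * (1 / σ) :=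
      mul_le_mul hw1 hw2 (by positivity) (by positivity)
    have ha : 4 * ca * cb * V * (1 - jr / kr) + 4 * cb ^ 2 * V * (jr / kr) * (1 / sh)
        ≤ 2 * ca * ((kr - jr) / jr) / σ ^ 2 + 2 * cb / σ ^ 3 := by
      have hpre1 : 0 ≤ 2 * ca * ((kr - jr) / jr) := by
        have : 0 ≤ (kr - jr) / jr := div_nonneg (by linarith) hjr.le
        positivity
      have t1 : 2 * ca * ((kr - jr) / jr) * (2 * cb * V * (jr / kr)) ≤ 2 * ca * ((kr - jr) / jr) * (1 / σ ^ 2) :=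
        mul_le_mul_of_nonneg_left hw1 hpre1
      have t2 : 2 * cb * (2 * cb * V * (jr / kr) * (1 / sh)) ≤ 2 * cb * (1 / σ ^ 2 * (1 / σ)) :=
        mul_le_mul_of_nonneg_left hw3 (by positivity)
      have e1 : 4 * ca * cb * V * (1 - jr / kr) = 2 * ca * ((kr - jr) / jr) * (2 * cb * V * (jr / kr)) := by
        field_simp
        ring
      have e2 : 4 * cb ^ 2 * V * (jr / kr) * (1 / sh) = 2 * cb * (2 * cb * V * (jr / kr) * (1 / sh)) := by ring
      have e3 : 2 * ca * ((kr - jr) / jr) / σ ^ 2 = 2 * ca * ((kr - jr) / jr) * (1 / σ ^ 2) := by ring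
      have e4 : 2 * cb / σ ^ 3 = 2 * cb * (1 / σ ^ 2 * (1 / σ)) := by field_simp
      rw [e1, e2, e3, e4]
      exact add_le_add t1 t2
    have hmono : 4 * ca * cb * V * (1 - 1 / F₁) + 4 * cb ^ 2 * V / (F₁ * sh)
        ≤ 4 * ca * cb * V * (1 - jr / kr) + 4 * cb ^ 2 * V * (jr / kr) * (1 / sh) := by
      have hD : 4 * cb ^ 2 * V * (1 / sh) ≤ 4 * ca * cb * V := by
        rw [show 4 * cb ^ 2 * V * (1 / sh) = 4 * cb ^ 2 * V / sh by ring, div_le_iff₀ hsh]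
        nlinarith [mul_le_mul_of_nonneg_left hc4 (by positivity : (0 : ℝ) ≤ 4 * cb * V)]
      have e1 : 4 * ca * cb * V * (1 - 1 / F₁) + 4 * cb ^ 2 * V / (F₁ * sh)
          = 4 * ca * cb * V - (4 * ca * cb * V - 4 * cb ^ 2 * V * (1 / sh)) * (1 / F₁) := by
        field_simp
        ring
      have e2 : 4 * ca * cb * V * (1 - jr / kr) + 4 * cb ^ 2 * V * (jr / kr) * (1 / sh)
          = 4 * ca * cb * V - (4 * ca * cb * V - 4 * cb ^ 2 * V * (1 / sh)) * (jr / kr) := by ring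
      rw [e1, e2]
      linarith [mul_le_mul_of_nonneg_left ht1 (sub_nonneg.2 hD)]
    have haV : 1 ≤ V * (2 * ca * ((kr - jr) / jr) / σ ^ 2 + 2 * cb / σ ^ 3) :=
      hc5.trans (mul_le_mul_of_nonneg_left (hmono.trans ha) hV.le)
    have h1 : x ≤ V * ((2 * ca * ((kr - jr) / jr) / σ ^ 2 + 2 * cb / σ ^ 3) * x) := by
      linarith [mul_le_mul_of_nonneg_left haV hx]
    have h2 : y ≤ V * (2 * cK * y) := by linarith [mul_le_mul_of_nonneg_left hcKV hy]
    linarith [mul_le_mul_of_nonneg_left hK hV.le]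

end Summit.QuantumFields.BalabanUV.Beta.EriceRemainderEnclosureHistoryAutonomyComparisonAgeCompositionOldPairLetters
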